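import Summits.HubbardSuperconductivity.HubbardSuperconductivity.Theorems.AnisotropyChordTransferFibre3N1RowL2Cover
import Summits.HubbardSuperconductivity.HubbardSuperconductivity.Theorems.AnisotropyChordTransferFibre3N1RowL2N30407A0000

/-!
# Route `AnisotropyChord` / H0 rotor rung, LEVEL 2 row `N₁`: the whole `ν`-column `[30407, 31000]/10⁶` (all `a`)

Assembly of the 1 certified `a`-cells of the column `ν = λ₂/θ² ∈ [0.030407, 0.031]` (files `…N1RowL2N30407A….lean`):
their `a`-ranges are contiguous from `0` to `amax = 1/40 ≥ AbarQ(ν₁) = 0.013659` (the `L`-uniform outer edge of the manifold band,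
`…N1RowL2Cover.a_le_AbarQ`), so EVERY ground profile of the column is covered:
★★ `trialGap_colN30407`: for every `L ≥ 128` and every ground two-magnon profile (`0 ≤ Δ < 1`) with `ν ∈ [30407, 31000]/10⁶`:
`(17/50)·U ≤ N₁` (the minimum of the cells' constants 17/50).
Generated by p2 g5's cells/mkcol_all.py.
Prover seat `hubbard-h0-rotor-p2` g5; helper for piece A = stmt-HubbardSuperconductivity-23918 of rung 19089
(`--supports`, helper class).  Nothing here proves superconductivity in the Hubbard model; assembly of kernel-certified cells of ONE
conditional reduction (the GM₃ ∀L certificate, Level-2 row `N₁`); the rotor TARGET as originally worded stays FALSE (g15 verdict).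
Mathlib + the tree only; no sorry.
-/

set_option linter.dupNamespace false
set_option autoImplicit false

open Literature.Analysis.ValidatedNumerics

namespace Summit.HubbardSuperconductivity.HubbardSuperconductivity.Theorems.AnisotropyChord.Transfer.Fibre3.L2.N1

/-- ★★ the whole column: `ν ∈ [30407, 31000]/10⁶`, every `a` ⟹ `(17/50)·U ≤ N₁` for all `L ≥ 128`. -/
theorem trialGap_colN30407 (L : ℕ) [NeZero L] (hL : 128 ≤ L) {Δ lam2 : ℝ} {f : Tor L → ℝ} (hΔ0 : 0 ≤ Δ) (hΔ1 : Δ < 1)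
    (hf : IsGroundTwoMagnon L Δ lam2 f)
    (hν1 : (30407 : ℝ) / 1000000 ≤ lam2 / (2 * Real.pi / L) ^ 2) (hν2 : lam2 / (2 * Real.pi / L) ^ 2 ≤ (31000 : ℝ) / 1000000) :
    ((17 : ℝ) / 50) * Uunit L Δ f ≤ trialGapN1 L Δ f := by
  obtain ⟨ha0, hν0, _⟩ := region_sides L hL hΔ0 hΔ1 hf
  have ha0' : ((0 : ℝ) / 1) ≤ Δ * f (K1 L) := by simpa using ha0
  have hab := a_le_AbarQ L hL hΔ0 hΔ1 hf
  set ν := lam2 / (2 * Real.pi / L) ^ 2 with hν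
  have hmono : 16384 / 16383 * (1 - 16143 / 500 * ν - 49979 / 10000 * ν ^ 2)
      ≤ 16384 / 16383 * (1 - 16143 / 500 * ((30407 : ℝ) / 1000000) - 49979 / 10000 * ((30407 : ℝ) / 1000000) ^ 2) := by
    have h1 : 0 ≤ ν - (30407 : ℝ) / 1000000 := by linarith only [hν1]
    have h2 : 0 ≤ (ν - (30407 : ℝ) / 1000000) * (ν + (30407 : ℝ) / 1000000) := mul_nonneg h1 (by linarith only [hν1, hν0])
    nlinarith only [h1, h2]
  have hamax : Δ * f (K1 L) ≤ ((1 : ℝ) / 40) := by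
    have : (16384 : ℝ) / 16383 * (1 - 16143 / 500 * ((30407 : ℝ) / 1000000) - 49979 / 10000 * ((30407 : ℝ) / 1000000) ^ 2) ≤ ((1 : ℝ) / 40) := by
      norm_num
    linarith only [hab, hmono, this]
  exact trialGap_mono L hΔ1.le hf (by omega) (show ((17 : ℝ) / 50) ≤ ((17 : ℝ) / 50) by norm_num)
        (trialGap_cellN30407A0000 L hL hΔ0 hΔ1 hf hν1 hν2 ha0' hamax)

end Summit.HubbardSuperconductivity.HubbardSuperconductivity.Theorems.AnisotropyChord.Transfer.Fibre3.L2.N1
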